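import Summits.PneNP.PneNP.Theorems.PhaseTwinsNoFBPPApproxAboveUniquenessCalibration
import Literature.Computability.Complexity.BFNWCase1
import Literature.Computability.Complexity.ExpTimeCollapsesProofs
import Literature.Computability.Complexity.EquivalenceProblemsCollapseProofs
import Literature.Computability.Complexity.UniformDerandomizationEndgame
import Literature.Computability.Complexity.PolyHierarchy

/-!
# Skeleton v2 (line `Sketch`, ideator 2: cards `split-exp-bpp-io-subexp` + `blowup-physics-free-feeder`) for crux
stmt-PneNP-2717 `Summit.PneNP.PneNP.Theses.PhaseTwins.NoFBPPApproxAboveUniqueness` (=: X)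

Lead: prover-line-stmt-PneNP-2717-1 (continuation seat; line `SketchIdeator1` was driven to the end by lead-0 and is
dead: its residual stub is `¬(NP ⊆ BPP)`, which IS the crux — `noFBPPApproxAboveUniqueness_iff_not_NP_subset_BPP`,
kernel-checked fact-free, `Theorems/PhaseTwinsNoFBPPApproxAboveUniquenessCalibration.lean`, p93858).

HONEST STATUS OF THIS LINE. The composition `NoFBPPApproxAboveUniqueness_of` below is ideator 2's `noFBPP_of_split`
made fact-free (the GŠV16 named fact replaced by the landed calibration): X from the two stubs
`stub_EXP_ne_BPP : EXP ≠ BPP` and `stub_NP_not_ioSubexp : ∃ ε > 0, NP ⊄ io-DTIME(2^{⌈n^ε⌉})`. BOTH are open conjectures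
and the second alone implies the summit (`P ⊆ DTIME(2^{⌈n^ε⌉}) ⊆ io-DTIME(·)`), so no worker is briefed on them: the
line cannot close X (TRIAGE-r1-1 "dominated by the plain calibration", TRIAGE-r1-2 rule (iv)). Its one PROVABLE
registered stub is the feeder identity of card `blowup-physics-free-feeder`, `stub_blowup`
(`Z_{G[K̄_t]}(z) = Z_G((1+z)^t − 1)`), which lands `--supports stmt-PneNP-2717` as a ladder tool (blow-ups preserve
`C^k`-equivalence and move the activity); it does not feed X. Card `approximate-cocycle`'s transfer is left as a
remark (TRIAGE: "not a `Lines/` skeleton; no consumer").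
-/

set_option linter.dupNamespace false

namespace Summit.PneNP.PneNP.Theorems.NoFBPPApproxAboveUniqueness

open Literature.Computability.Complexity Literature.Probability.LatticeModels
open _root_.Computability Polynomial
open Summit.PneNP.PneNP.Theses.PhaseTwins (NoFBPPApproxAboveUniqueness)

/-! ### The two open ends of the split (conjectures; NOT delegated) -/

/-- **Stub (open conjecture).** `EXP ≠ BPP`. Believed true; open (no worker is briefed). [folklore] -/
theorem stub_EXP_ne_BPP : EXP ≠ BPP := by
  sorry

/-- **Stub (open conjecture, above the summit).** For some `ε > 0`, `NP ⊄ io-DTIME(2^{⌈n^ε⌉})` — an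
almost-everywhere sub-exponential lower bound for `NP`; it implies `P ≠ NP` outright. No worker is briefed. [folklore] -/
theorem stub_NP_not_ioSubexp :
    ∃ ε : ℝ, 0 < ε ∧ ¬ Nondeterministic.NP ⊆ io (DTIME fun n => 2 ^ ⌈(n : ℝ) ^ ε⌉₊) := by
  sorry

/-! ### The split (ideator 2, proved): `EXP ≠ BPP ∧ NP ⊄ io-SUBEXP_ε ⟹ NP ⊄ BPP` -/

/-- **Split.** `EXP ≠ BPP` together with "for some `ε > 0`, `NP ⊄ io-DTIME(2^{⌈n^ε⌉})`" gives `NP ⊄ BPP` —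
Ko/Zachos (`PH ⊆ BPP` under `NP ⊆ BPP`), Meyer (`EXP ⊆ P/poly → EXP = Σ₂ᵖ`) and the Babai–Fortnow–Nisan–Wigderson
i.o. simulation (`EXP ⊄ P/poly → BPP ⊆ io-DTIME(2^{n^ε})`), all proved in the tree (proof: ideator 2's
`np_not_subset_bpp_of_split`, verbatim). [cite: BabaiFortnowNisanWigderson1993, Thm 1.2] -/
theorem not_NP_subset_BPP_of_split (h₁ : EXP ≠ BPP)
    (h₂ : ∃ ε : ℝ, 0 < ε ∧ ¬ Nondeterministic.NP ⊆ io (DTIME fun n => 2 ^ ⌈(n : ℝ) ^ ε⌉₊)) :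
    ¬ Nondeterministic.NP ⊆ BPP := by
  intro hNP
  obtain ⟨ε, hε, hio⟩ := h₂
  have hPH : PH ⊆ BPP := PH_subset_BPP_of_NP_subset_BPP hNP
  have hEXP : ¬ EXP ⊆ PPoly := by
    intro hsub
    have hSig : EXP = SigmaP 2 := EXP_eq_SigmaP_two_of_subset_PPoly_holds hsub
    apply h₁
    apply Set.Subset.antisymm
    · rw [hSig]
      exact (SigmaP_subset_PH 2).trans hPH
    · exact BPP_subset_EXP
  exact hio (hNP.trans (BPP_subset_io_DTIME_of_not_EXP_subset_PPoly hEXP hε))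

/-! ### Composition (fact-free): the crux by name from the two open ends -/

/-- **Composition.** X from `stub_EXP_ne_BPP` and `stub_NP_not_ioSubexp` via the split and the landed fact-free
calibration half `noFBPPApproxAboveUniqueness_of_not_NP_subset_BPP` (p93858). [folklore] -/
theorem NoFBPPApproxAboveUniqueness_of : NoFBPPApproxAboveUniqueness :=
  noFBPPApproxAboveUniqueness_of_not_NP_subset_BPP (not_NP_subset_BPP_of_split stub_EXP_ne_BPP stub_NP_not_ioSubexp)

/-! ### Feeder stub of card `blowup-physics-free-feeder` — LANDED (worker, p96313)

`stub_blowup : Z_{G[K̄_t]}(z) = Z_G((1+z)^t − 1)` is `Theorems/PhaseTwinsNoFBPPApproxAboveUniquenessBlowup.lean`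
(same namespace, same registered name and signature; with its `λ = 1` corollary `#IS(G[K̄_t]) = Z_G(2^t − 1)` one `norm_num` away), so it is no longer restated here and — feeding nothing in the composition — not imported either. The lead's registered
sub-goal `noFBPPApproxAboveUniqueness_iff_NP_ne_RP` (X ↔ NP ≠ RP, fact-free) and the conjecture web
(`NPNotSubsetPPoly → X`, `OWFExist → X`, `X → PneNP`) are `Theorems/PhaseTwinsNoFBPPApproxAboveUniquenessConjectureWeb.lean`
(p96055). OPEN after cycle 1: exactly the two conjecture stubs above — the line is dead by construction
(`Lines/Sketch-dead.md`). -/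

end Summit.PneNP.PneNP.Theorems.NoFBPPApproxAboveUniqueness
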